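import Mathlib
import Summits.QuantumFields.QCD.Theses.SpectralDefectExtinction

/-!
# The hole of the free `r = 1` Wilson–Dirac spectrum (item stmt-QuantumFields-8969)

Support item `HoleLemma` of route `SpectralDefectExtinction`: for every `p ∈ ℝ⁴` and `t ∈ [0,2]`,
`(Σ_μ (1 − cos p_μ) − t)² + Σ_μ sin² p_μ ≥ min(t, 2 − t)²`, i.e. the free massless `r = 1`
Wilson–Dirac symbol `W(p) ± i|s(p)|` stays at distance `≥ min(t, 2 − t)` from the real point `t`
(the real segment `(0,2)` is a hole of the free spectrum; Neuberger 2000, Berruto–Narayanan–Neuberger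
2000 §2). Elementary proof: with `w_μ = 1 − cos p_μ ∈ [0,2]` one has `sin² p_μ = w_μ (2 − w_μ)`;
writing `S = Σ w_μ`, the right-hand side is `(S − t)² + 2S − Σ w_μ²`; if `S ≤ 2` use
`Σ w_μ² ≤ S²` (giving `≥ t² + 2S(1 − t)`, split `t ≶ 1`), if `S ≥ 2` use `w_μ(2 − w_μ) ≥ 0` and
`(S − t)² ≥ (2 − t)²`.
-/

namespace Summit.QuantumFields.QCD.Theorems

/-- Polynomial core of the hole lemma: for `a b c d ∈ [0,2]` and `t ≤ 2`,
`min(t,2−t)² ≤ (a+b+c+d−t)² + (a(2−a) + b(2−b) + c(2−c) + d(2−d))`. -/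
theorem holeLemma_poly (a b c d t : ℝ) (ha : 0 ≤ a) (ha2 : a ≤ 2) (hb : 0 ≤ b) (hb2 : b ≤ 2)
    (hc : 0 ≤ c) (hc2 : c ≤ 2) (hd : 0 ≤ d) (hd2 : d ≤ 2) (ht2 : t ≤ 2) :
    min t (2 - t) ^ 2 ≤
      (a + b + c + d - t) ^ 2 + (a * (2 - a) + b * (2 - b) + c * (2 - c) + d * (2 - d)) := by
  rcases le_total (a + b + c + d) 2 with hS | hS
  · -- `S ≤ 2`: use `Σ w² ≤ S²`, i.e. the pairwise products are nonnegative
    rcases le_total t 1 with h1 | h1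
    · rw [min_eq_left (by linarith)]
      nlinarith [mul_nonneg ha hb, mul_nonneg ha hc, mul_nonneg ha hd, mul_nonneg hb hc,
        mul_nonneg hb hd, mul_nonneg hc hd, mul_nonneg ha (sub_nonneg.2 h1),
        mul_nonneg hb (sub_nonneg.2 h1), mul_nonneg hc (sub_nonneg.2 h1),
        mul_nonneg hd (sub_nonneg.2 h1)]
    · rw [min_eq_right (by linarith)]
      nlinarith [mul_nonneg ha hb, mul_nonneg ha hc, mul_nonneg ha hd, mul_nonneg hb hc,
        mul_nonneg hb hd, mul_nonneg hc hd, mul_nonneg (sub_nonneg.2 hS) (sub_nonneg.2 h1)]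
  · -- `S ≥ 2`: each `w(2−w) ≥ 0` and `(S − t)² ≥ (2 − t)² ≥ min(t,2−t)²`
    have hmin : min t (2 - t) ^ 2 ≤ (2 - t) ^ 2 := by
      rcases le_total t 1 with h1 | h1
      · rw [min_eq_left (by linarith)]
        nlinarith
      · rw [min_eq_right (by linarith)]
    nlinarith [mul_nonneg ha (sub_nonneg.2 ha2), mul_nonneg hb (sub_nonneg.2 hb2),
      mul_nonneg hc (sub_nonneg.2 hc2), mul_nonneg hd (sub_nonneg.2 hd2),
      mul_nonneg (sub_nonneg.2 hS) (by linarith : (0:ℝ) ≤ a + b + c + d + 2 - 2 * t)]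

/-- **Hole lemma** (item stmt-QuantumFields-8969, route decl
`Summit.QuantumFields.QCD.Theses.SpectralDefectExtinction.HoleLemma`): for every `p : Fin 4 → ℝ`
and `t ∈ [0,2]`, `min(t, 2−t)² ≤ (Σ_μ (1 − cos p_μ) − t)² + Σ_μ sin² p_μ` — the free massless
`r = 1` Wilson–Dirac symbol keeps distance `≥ min(t,2−t)` from the real point `t`. -/
theorem holeLemma_proof : Summit.QuantumFields.QCD.Theses.SpectralDefectExtinction.HoleLemma := by
  unfold Summit.QuantumFields.QCD.Theses.SpectralDefectExtinction.HoleLemma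
  intro p t _ ht2
  have hw0 : ∀ μ, 0 ≤ 1 - Real.cos (p μ) := fun μ => sub_nonneg.2 (Real.cos_le_one _)
  have hw2 : ∀ μ, 1 - Real.cos (p μ) ≤ 2 := fun μ => by linarith [Real.neg_one_le_cos (p μ)]
  have hsin : ∀ μ, Real.sin (p μ) ^ 2 = (1 - Real.cos (p μ)) * (2 - (1 - Real.cos (p μ))) :=
    fun μ => by nlinarith [Real.sin_sq_add_cos_sq (p μ)]
  simp only [Fin.sum_univ_four, hsin]
  exact holeLemma_poly _ _ _ _ t (hw0 0) (hw2 0) (hw0 1) (hw2 1) (hw0 2) (hw2 2) (hw0 3) (hw2 3) ht2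

end Summit.QuantumFields.QCD.Theorems
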